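import Literature.Analysis.FunctionSpaces.TorusClassicalNSBackwardUniqueness
import Literature.Analysis.FunctionSpaces.TorusLinearisedNSGrowth
import Literature.Analysis.FluidPDE.TorusLinearisedNSH1Balance
import HarnessLib

/-!
# Backward uniqueness for the linearised Navier–Stokes equation along a smooth field on the
# flat torus (injectivity of the derivative cocycle)

Function-space support file (all results proved; no definitions, no named facts), the LINEAR twin
of `TorusClassicalNSBackwardUniqueness` (backward uniqueness of classical solutions by the
log-convexity / Dirichlet-quotient method) and the backward complement of the forward uniqueness of
`TorusLinearisedNSEnergy` / `TorusLinearisedNSGrowth`. For jointly smooth solutions `(w, q)` of the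
linearised Navier–Stokes equation `∂ₜw + (u·∇)w + (w·∇)u = νΔw − ∇q`, `div w = 0`, along a jointly
smooth field `u` with divergence-free slices (clauses as separate hypotheses, no predicate):

* `Torus.linearisedNS_backward_eq_zero` — on `[a, b]`, `ν > 0`: `w(b) = 0` forces `w ≡ 0` on
  `[a, b]`;
* `Torus.linearisedNS_backward_unique` — two linearised solutions along the same `u` which agree
  at the final time `b` agree on `[a, b]` (linearity, `Torus.linearisedNS_sub_eq`);
* `Torus.linearisedNS_backward_unique_of_mem`, `Torus.linearisedNS_eq_of_eq`,
  `Torus.linearisedNS_eq_of_eq_Ici` — anchored versions on a convex time set / on `[0, ∞)`: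
  agreement at one time gives agreement at all earlier times, resp. at all times (with the forward
  uniqueness `Torus.linearisedNS_unique_of_mem`).

This is the INJECTIVITY of the linearised solution operators `S'(t, u₀) : ξ ↦ v(t, u₀, ξ)`
(Constantin–Foias 1988, Ch. 14, after (14.6): "`M(t, u₀)` is injective for every `t > 0`" — there
deduced from the backward uniqueness of Ch. 12, Theorem 12.2, whose proof is stated for the linear
equation `dv/dt + νAv = −B(u, v) − B(v, u)` verbatim; Temam 1997, Ch. III §6.1, Lemmas 6.1–6.2 for
`w' + νAw = L(t)w`, `‖L(t)w‖ ≤ k‖w‖_V`), one of the standing hypotheses on the derivative cocycle of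
semiflows on Hilbert spaces in smooth ergodic theory (Lian–Young 2012).

Proof road: word for word `Torus.IsClassicalNSSolutionOn.velocity_backward_unique` with the
linearised balance laws — `E' = −2νV − 2∫⟪(w·∇)u, w⟫`
(`Torus.linearisedNS_hasDerivWithinAt_integral_norm_sq`), `V' = −2ν‖Δw‖₂² + 2∫⟪C, Δw⟫`,
`C = (u·∇)w + (w·∇)u` (`Torus.linearisedNS_hasDerivWithinAt_half_gradNormSq`), the coefficient
bounds `|∫⟪(w·∇)u, w⟫| ≤ LE`, `‖C‖₂² ≤ 2|d|M²V + 2L²E` from `sup ‖u‖ ≤ M`, `sup ‖∂ᵢu‖ ≤ Cᵢ` on the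
compact `[a, b] × T^d`, Young in the form `Torus.integral_inner_laplacian_add_smul_le`, the
Dirichlet-quotient law `Literature.Analysis.ODE.dirichletQuotient_law_of_young`, and the
real-variable conclusion `Literature.Analysis.ODE.eq_zero_of_dirichletQuotient_law`.

## Mathlib / tree search

Tree (`lean search 'linearisedNS_backward|linearisedNS_eq_of_eq'`): none; reused: the lemmas listed
above, `Torus.integral_norm_sq_convect_add_convect_le` (`TorusClassicalNSDifferenceBalances`),
`Torus.integral_inner_convect_self_right_eq_zero`, `Torus.eq_zero_of_integral_norm_sq_nonpos`,
`Torus.linearisedNS_sub_eq`, `Torus.linearisedNS_mono`, `Torus.linearisedNS_unique_of_mem`,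
`Torus.IsSmoothSpaceTimeOn.exists_norm_le_of_isCompact`.

## References

* P. Constantin, C. Foias, *Navier–Stokes Equations*, Univ. Chicago Press 1988, Ch. 12,
  Theorem 12.2 (backward uniqueness), Ch. 14, (14.5)–(14.6) (injectivity of `S'(t, u₀)`).
  [`ConstantinFoiasNSE1988`]
* R. Temam, *Infinite-Dimensional Dynamical Systems in Mechanics and Physics*, 2nd ed., Springer
  1997, Ch. III §6.1, Lemmas 6.1–6.2 (the abstract linear backward uniqueness theorem).
  [`Temam1997`]
* Z. Lian, L.-S. Young, *Lyapunov exponents, periodic orbits, and horseshoes for semiflows on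
  Hilbert spaces*, J. Amer. Math. Soc. 25 (2012), §1 (injectivity of the derivative cocycle as a
  standing hypothesis).
-/

open MeasureTheory Set Filter
open scoped InnerProductSpace ContDiff Topology

noncomputable section

namespace Literature.Analysis.FunctionSpaces

namespace Torus

variable {d : Type*} [Fintype d] [DecidableEq d]

/-! ## Backward uniqueness on a compact time interval -/

section Main

variable {a b ν : ℝ} {u w : ℝ → UnitAddTorus d → EuclideanSpace ℝ d} {q : ℝ → UnitAddTorus d → ℝ}

/-- **Backward uniqueness for the linearised Navier–Stokes equation on the torus: zero final value
gives the zero solution.** Let `u` be jointly smooth on `[a, b] × T^d` (`a < b`) with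
divergence-free slices and let `(w, q)` be a jointly smooth solution of
`∂ₜw + (u·∇)w + (w·∇)u = νΔw − ∇q`, `div w = 0` on `[a, b]` (`ν > 0`). If `w(b) = 0` then `w(t) = 0`
for all `t ∈ [a, b]`: with `E = ∫‖w‖²`, `V = ‖∇w‖₂²`, the linearised balance laws give
`E' ≥ −(2νV + 2LE)` and the Dirichlet-quotient law `V'E − VE' ≤ K(V + E)E`,
`K = (|d|M² + L²)/ν` (`M = sup ‖u‖`, `L = ∑ᵢ sup ‖∂ᵢu‖` on the compact `[a, b] × T^d`), so
`E(b) = 0` forces `E ≡ 0` (Constantin–Foias 1988, Theorem 12.2, whose proof is written for exactly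
this linear equation; Temam 1997, Ch. III, Lemma 6.2). [cite: ConstantinFoiasNSE1988, Ch. 12 Theorem 12.2] -/
theorem linearisedNS_backward_eq_zero (hν : 0 < ν) (hab : a < b)
    (hu : IsSmoothSpaceTimeOn (Icc a b) u) (hudiv : ∀ t ∈ Icc a b, IsDivFree (u t))
    (hw : IsSmoothSpaceTimeOn (Icc a b) w) (hq : IsSmoothSpaceTimeOn (Icc a b) q)
    (hwdiv : ∀ t ∈ Icc a b, IsDivFree (w t))
    (hlin : ∀ t ∈ Icc a b, ∀ x, timeDerivWithin (Icc a b) w t x + convect (u t) (w t) x +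
      convect (w t) (u t) x = ν • laplacian (w t) x - gradient (q t) x)
    (hb : w b = 0) : ∀ t ∈ Icc a b, w t = 0 := by
  classical
  intro t ht
  have hU : UniqueDiffOn ℝ (Icc a b) := uniqueDiffOn_Icc hab
  -- uniform bounds on the compact `[a, b] × T^d`
  obtain ⟨M, hM⟩ : ∃ M : ℝ, ∀ s ∈ Icc a b, ∀ x, ‖u s x‖ ≤ M :=
    hu.exists_norm_le_of_isCompact isCompact_Icc subset_rfl
  obtain ⟨C, hC⟩ : ∃ C : d → ℝ, ∀ i, ∀ s ∈ Icc a b, ∀ x, ‖partialDeriv i (u s) x‖ ≤ C i := by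
    have hbd : ∀ i : d, ∃ c : ℝ, ∀ s ∈ Icc a b, ∀ x, ‖partialDeriv i (u s) x‖ ≤ c := fun i =>
      (hu.partialDeriv hU i).exists_norm_le_of_isCompact isCompact_Icc subset_rfl
    choose C hC using hbd
    exact ⟨C, hC⟩
  set L : ℝ := ∑ i, C i with hL_def
  set K : ℝ := (Fintype.card d * M ^ 2 + L ^ 2) / ν with hK_def
  have hK0 : 0 ≤ K := by positivity
  -- the two functions of time and their derivatives
  set E : ℝ → ℝ := fun s => ∫ x, ‖w s x‖ ^ 2 with hE_def
  set V : ℝ → ℝ := fun s => gradNormSq (w s) with hV_def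
  set R : ℝ → ℝ := fun s => ∫ x, ⟪convect (w s) (u s) x, w s x⟫_ℝ with hR_def
  set D : ℝ → ℝ := fun s => ∫ x, ‖laplacian (w s) x‖ ^ 2 with hD_def
  set P : ℝ → ℝ := fun s => ∫ x, ⟪convect (u s) (w s) x + convect (w s) (u s) x,
    laplacian (w s) x⟫_ℝ with hP_def
  set E' : ℝ → ℝ := fun s => -(2 * ν * V s) - 2 * R s with hE'_def
  set V' : ℝ → ℝ := fun s => -(2 * ν * D s) + 2 * P s with hV'_def
  have hE : ∀ s ∈ Icc a b, HasDerivWithinAt E (E' s) (Icc a b) s := fun s hs =>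
    linearisedNS_hasDerivWithinAt_integral_norm_sq hu hudiv hw hq hwdiv hlin hab hs
  have hV : ∀ s ∈ Icc a b, HasDerivWithinAt V (V' s) (Icc a b) s := by
    intro s hs
    have h := (Literature.Analysis.FluidPDE.Torus.linearisedNS_hasDerivWithinAt_half_gradNormSq
      hu hw hq hwdiv hlin hab hs).const_mul 2
    have hfun : (fun r => 2 * (2⁻¹ * gradNormSq (w r))) = V := by
      funext r
      simp only [hV_def]
      ring
    rw [hfun] at h
    refine h.congr_deriv ?_
    simp only [hV'_def, hD_def, hP_def]
    ring
  have hE0 : ∀ s ∈ Icc a b, 0 ≤ E s := fun s _ => integral_nonneg fun x => sq_nonneg _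
  have hV0 : ∀ s ∈ Icc a b, 0 ≤ V s := fun s _ => gradNormSq_nonneg _
  -- the energy inequality `E' ≥ -(2νV + 2LE)`
  have hlow : ∀ s ∈ Icc a b, 0 < E s → -(2 * ν * V s + 2 * L * E s) ≤ E' s := by
    intro s hs _
    have hR := abs_integral_inner_convect_le (hu.isSmooth_slice hs) (hw.isSmooth_slice hs)
      fun i x => hC i s hs x
    have hR' := (abs_le.1 hR).2
    simp only [hE'_def]
    linarith
  -- the Dirichlet-quotient law `V'E - VE' ≤ K(V + E)E`
  have hquot : ∀ s ∈ Icc a b, 0 < E s → V' s * E s - V s * E' s ≤ K * (V s + E s) * E s := by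
    intro s hs hEs
    have hws : IsSmooth (w s) := hw.isSmooth_slice hs
    have hus : IsSmooth (u s) := hu.isSmooth_slice hs
    have hCs : IsSmooth (fun x => convect (u s) (w s) x + convect (w s) (u s) x) :=
      (hus.convect hws).add (hws.convect hus)
    set Q : ℝ := ∫ x, ⟪convect (u s) (w s) x + convect (w s) (u s) x, w s x⟫_ℝ with hQ_def
    set N : ℝ := ∫ x, ‖convect (u s) (w s) x + convect (w s) (u s) x‖ ^ 2 with hN_def
    -- `Q = R s`: the transport term vanishes
    have hQR : Q = R s := by
      simp only [hQ_def, hR_def]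
      simp_rw [inner_add_left]
      rw [integral_add (((hus.convect hws).inner hws).integrable)
          (((hws.convect hus).inner hws).integrable),
        integral_inner_convect_self_right_eq_zero hus (hudiv s hs) hws, zero_add]
    -- `∫ ⟪Δw, w⟫ = -V`
    have hJ : ∫ x, ⟪laplacian (w s) x, w s x⟫_ℝ = -V s :=
      Literature.Analysis.FluidPDE.Torus.integral_inner_laplacian_self_eq_neg_gradNormSq hws
    -- Young, for every `λ`
    have hyoung : ∀ l : ℝ, P s + l * Q ≤ ν * (D s + 2 * l * -V s + l ^ 2 * E s) + (4 * ν)⁻¹ * N := by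
      intro l
      have h := integral_inner_laplacian_add_smul_le hCs hws hν l
      rw [hJ] at h
      exact h
    have hlaw := Literature.Analysis.ODE.dirichletQuotient_law_of_young hEs hν hyoung
    -- `N ≤ 2|d|M²V + 2L²E`
    have hN : N ≤ 2 * (Fintype.card d * M ^ 2) * V s + 2 * L ^ 2 * E s :=
      integral_norm_sq_convect_add_convect_le hus hws (fun x => hM s hs x) fun i x => hC i s hs x
    have hNK : N / (2 * ν) * E s ≤ K * (V s + E s) * E s := by
      refine mul_le_mul_of_nonneg_right ?_ hEs.le
      rw [div_le_iff₀ (by positivity : (0 : ℝ) < 2 * ν)]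
      have e : K * (V s + E s) * (2 * ν) =
          2 * ((Fintype.card d * M ^ 2 + L ^ 2) * (V s + E s)) := by
        simp only [hK_def]
        field_simp
      rw [e]
      have hVs := hV0 s hs
      have h1 : 0 ≤ Fintype.card d * M ^ 2 * E s := by positivity
      have h2 : 0 ≤ L ^ 2 * V s := by positivity
      nlinarith [hN, h1, h2]
    have hrew : V' s * E s - V s * E' s =
        (-(2 * ν * D s) + 2 * P s) * E s - V s * (-(2 * ν * V s) - 2 * Q) := by
      rw [hQR]
    rw [hrew]
    exact hlaw.trans hNK
  -- conclusion
  have hEb : E b = 0 := by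
    simp [hE_def, hb]
  have hEt : E t = 0 := Literature.Analysis.ODE.eq_zero_of_dirichletQuotient_law hE hV hE0 hV0 hK0
    (by positivity) hlow hquot hEb ht
  exact eq_zero_of_integral_norm_sq_nonpos (hw.isSmooth_slice ht) (le_of_eq hEt)

variable {w₁ w₂ : ℝ → UnitAddTorus d → EuclideanSpace ℝ d} {q₁ q₂ : ℝ → UnitAddTorus d → ℝ}

/-- **Backward uniqueness for the linearised Navier–Stokes equation on a compact time interval.**
Two linearised solutions `(w₁, q₁)`, `(w₂, q₂)` along the same smooth divergence-free field `u` on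
`[a, b] × T^d` (`ν > 0`, `a < b`) which agree at the final time, `w₁(b) = w₂(b)`, agree on
`[a, b]` (linearity, `Torus.linearisedNS_sub_eq`, and `Torus.linearisedNS_backward_eq_zero`) — the
injectivity of the linearised solution operator `ξ ↦ S'(t, u₀)ξ` (Constantin–Foias 1988, Ch. 14,
after (14.6)). [cite: ConstantinFoiasNSE1988, Ch. 14 (14.5)–(14.6)] -/
theorem linearisedNS_backward_unique (hν : 0 < ν) (hab : a < b)
    (hu : IsSmoothSpaceTimeOn (Icc a b) u) (hudiv : ∀ t ∈ Icc a b, IsDivFree (u t))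
    (hw₁ : IsSmoothSpaceTimeOn (Icc a b) w₁) (hq₁ : IsSmoothSpaceTimeOn (Icc a b) q₁)
    (hwdiv₁ : ∀ t ∈ Icc a b, IsDivFree (w₁ t))
    (hlin₁ : ∀ t ∈ Icc a b, ∀ x, timeDerivWithin (Icc a b) w₁ t x + convect (u t) (w₁ t) x +
      convect (w₁ t) (u t) x = ν • laplacian (w₁ t) x - gradient (q₁ t) x)
    (hw₂ : IsSmoothSpaceTimeOn (Icc a b) w₂) (hq₂ : IsSmoothSpaceTimeOn (Icc a b) q₂)
    (hwdiv₂ : ∀ t ∈ Icc a b, IsDivFree (w₂ t))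
    (hlin₂ : ∀ t ∈ Icc a b, ∀ x, timeDerivWithin (Icc a b) w₂ t x + convect (u t) (w₂ t) x +
      convect (w₂ t) (u t) x = ν • laplacian (w₂ t) x - gradient (q₂ t) x)
    (hb : w₁ b = w₂ b) : ∀ t ∈ Icc a b, w₁ t = w₂ t := by
  intro t ht
  have hdiv : ∀ s ∈ Icc a b, IsDivFree (fun y => w₁ s y - w₂ s y) := by
    intro s hs x
    have h12 : (fun y => w₁ s y - w₂ s y) = w₁ s - w₂ s := rfl
    rw [h12, divergence_sub ((hw₁.isSmooth_slice hs).isContDiff (by simp))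
      ((hw₂.isSmooth_slice hs).isContDiff (by simp)), hwdiv₁ s hs x, hwdiv₂ s hs x, sub_zero]
  have hz := linearisedNS_backward_eq_zero hν hab hu hudiv (hw₁.sub hw₂) (hq₁.sub hq₂) hdiv
    (fun s hs x => linearisedNS_sub_eq hw₁ hq₁ hlin₁ hw₂ hq₂ hlin₂ hab hs x)
    (by funext y; simp [hb]) t ht
  funext y
  exact sub_eq_zero.1 (congrFun hz y)

end Main

/-! ## Anchored versions on convex time sets -/

section Anchors

variable {S : Set ℝ} {ν : ℝ} {u w₁ w₂ : ℝ → UnitAddTorus d → EuclideanSpace ℝ d}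
  {q₁ q₂ : ℝ → UnitAddTorus d → ℝ}

/-- **Backward uniqueness of linearised solutions from any anchor time.** Two linearised solutions
along the same smooth divergence-free `u` on a convex time set `S` (`ν > 0`) which agree at
`t₀ ∈ S` agree at every earlier time of `S` (restrict to `[t, t₀] ⊆ S`, `Torus.linearisedNS_mono`,
and apply `Torus.linearisedNS_backward_unique`). [cite: ConstantinFoiasNSE1988, Ch. 12 Theorem 12.2] -/
theorem linearisedNS_backward_unique_of_mem (hν : 0 < ν) (hS : Convex ℝ S)
    (hu : IsSmoothSpaceTimeOn S u) (hudiv : ∀ t ∈ S, IsDivFree (u t))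
    (hw₁ : IsSmoothSpaceTimeOn S w₁) (hq₁ : IsSmoothSpaceTimeOn S q₁)
    (hwdiv₁ : ∀ t ∈ S, IsDivFree (w₁ t))
    (hlin₁ : ∀ t ∈ S, ∀ x, timeDerivWithin S w₁ t x + convect (u t) (w₁ t) x +
      convect (w₁ t) (u t) x = ν • laplacian (w₁ t) x - gradient (q₁ t) x)
    (hw₂ : IsSmoothSpaceTimeOn S w₂) (hq₂ : IsSmoothSpaceTimeOn S q₂)
    (hwdiv₂ : ∀ t ∈ S, IsDivFree (w₂ t))
    (hlin₂ : ∀ t ∈ S, ∀ x, timeDerivWithin S w₂ t x + convect (u t) (w₂ t) x +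
      convect (w₂ t) (u t) x = ν • laplacian (w₂ t) x - gradient (q₂ t) x)
    {t₀ : ℝ} (ht₀ : t₀ ∈ S) (h0 : w₁ t₀ = w₂ t₀) {t : ℝ} (ht : t ∈ S) (htt₀ : t ≤ t₀) :
    w₁ t = w₂ t := by
  rcases eq_or_lt_of_le htt₀ with rfl | hlt
  · exact h0
  · have hsub : Icc t t₀ ⊆ S := hS.ordConnected.out ht ht₀
    have hU : UniqueDiffOn ℝ (Icc t t₀) := uniqueDiffOn_Icc hlt
    exact linearisedNS_backward_unique hν hlt (hu.mono hsub) (fun s hs => hudiv s (hsub hs))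
      (hw₁.mono hsub) (hq₁.mono hsub) (fun s hs => hwdiv₁ s (hsub hs))
      (fun s hs x => linearisedNS_mono hw₁ hlin₁ hsub hU hs x)
      (hw₂.mono hsub) (hq₂.mono hsub) (fun s hs => hwdiv₂ s (hsub hs))
      (fun s hs x => linearisedNS_mono hw₂ hlin₂ hsub hU hs x) h0 t ⟨le_rfl, hlt.le⟩

/-- **Linearised solutions are determined by their value at any one time** (forward uniqueness
`Torus.linearisedNS_unique_of_mem` and backward uniqueness
`Torus.linearisedNS_backward_unique_of_mem`): on a convex time set `S`, two linearised solutions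
along the same smooth divergence-free `u` (`ν > 0`) which agree at some `t₀ ∈ S` agree on all of
`S`. [cite: ConstantinFoiasNSE1988, Ch. 14 (14.5)–(14.6)] -/
theorem linearisedNS_eq_of_eq (hν : 0 < ν) (hS : Convex ℝ S)
    (hu : IsSmoothSpaceTimeOn S u) (hudiv : ∀ t ∈ S, IsDivFree (u t))
    (hw₁ : IsSmoothSpaceTimeOn S w₁) (hq₁ : IsSmoothSpaceTimeOn S q₁)
    (hwdiv₁ : ∀ t ∈ S, IsDivFree (w₁ t))
    (hlin₁ : ∀ t ∈ S, ∀ x, timeDerivWithin S w₁ t x + convect (u t) (w₁ t) x +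
      convect (w₁ t) (u t) x = ν • laplacian (w₁ t) x - gradient (q₁ t) x)
    (hw₂ : IsSmoothSpaceTimeOn S w₂) (hq₂ : IsSmoothSpaceTimeOn S q₂)
    (hwdiv₂ : ∀ t ∈ S, IsDivFree (w₂ t))
    (hlin₂ : ∀ t ∈ S, ∀ x, timeDerivWithin S w₂ t x + convect (u t) (w₂ t) x +
      convect (w₂ t) (u t) x = ν • laplacian (w₂ t) x - gradient (q₂ t) x)
    {t₀ : ℝ} (ht₀ : t₀ ∈ S) (h0 : w₁ t₀ = w₂ t₀) {t : ℝ} (ht : t ∈ S) : w₁ t = w₂ t := by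
  rcases le_total t t₀ with h | h
  · exact linearisedNS_backward_unique_of_mem hν hS hu hudiv hw₁ hq₁ hwdiv₁ hlin₁ hw₂ hq₂ hwdiv₂
      hlin₂ ht₀ h0 ht h
  · exact linearisedNS_unique_of_mem hν.le hS hu hudiv hw₁ hq₁ hwdiv₁ hlin₁ hw₂ hq₂ hwdiv₂ hlin₂
      ht₀ h0 ht h

/-- **Injectivity of the derivative cocycle on `[0, ∞)`.** Two linearised solutions along the same
smooth divergence-free `u` on `[0, ∞) × T^d` (`ν > 0`) which agree at SOME time `t₀ ≥ 0` have the
same initial value (and then agree everywhere): `w₁(t₀) = w₂(t₀) → w₁(0) = w₂(0)`, i.e. the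
linearised solution operators `w(0) ↦ w(t₀)` are injective (Constantin–Foias 1988, Ch. 14, after
(14.6); the standing injectivity hypothesis on derivative cocycles of Lian–Young 2012).
[cite: ConstantinFoiasNSE1988, Ch. 14 (14.5)–(14.6)] -/
theorem linearisedNS_eq_of_eq_Ici (hν : 0 < ν)
    (hu : IsSmoothSpaceTimeOn (Ici 0) u) (hudiv : ∀ t ∈ Ici (0 : ℝ), IsDivFree (u t))
    (hw₁ : IsSmoothSpaceTimeOn (Ici 0) w₁) (hq₁ : IsSmoothSpaceTimeOn (Ici 0) q₁)
    (hwdiv₁ : ∀ t ∈ Ici (0 : ℝ), IsDivFree (w₁ t))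
    (hlin₁ : ∀ t ∈ Ici (0 : ℝ), ∀ x, timeDerivWithin (Ici 0) w₁ t x + convect (u t) (w₁ t) x +
      convect (w₁ t) (u t) x = ν • laplacian (w₁ t) x - gradient (q₁ t) x)
    (hw₂ : IsSmoothSpaceTimeOn (Ici 0) w₂) (hq₂ : IsSmoothSpaceTimeOn (Ici 0) q₂)
    (hwdiv₂ : ∀ t ∈ Ici (0 : ℝ), IsDivFree (w₂ t))
    (hlin₂ : ∀ t ∈ Ici (0 : ℝ), ∀ x, timeDerivWithin (Ici 0) w₂ t x + convect (u t) (w₂ t) x +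
      convect (w₂ t) (u t) x = ν • laplacian (w₂ t) x - gradient (q₂ t) x)
    {t₀ : ℝ} (ht₀ : 0 ≤ t₀) (h0 : w₁ t₀ = w₂ t₀) {t : ℝ} (ht : 0 ≤ t) : w₁ t = w₂ t :=
  linearisedNS_eq_of_eq hν (convex_Ici 0) hu hudiv hw₁ hq₁ hwdiv₁ hlin₁ hw₂ hq₂ hwdiv₂ hlin₂
    (mem_Ici.2 ht₀) h0 (mem_Ici.2 ht)

end Anchors

end Torus

end Literature.Analysis.FunctionSpaces
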